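import Mathlib.FieldTheory.RatFunc.AsPolynomial
import Mathlib.FieldTheory.Differential.Liouville
import Mathlib.Algebra.Polynomial.Derivation
import Mathlib.Data.Fintype.BigOperators
import Literature.NumberTheory.Transcendental.RosenlichtDifferentials
import Literature.NumberTheory.Transcendental.AxSchanuelProofs
import Literature.NumberTheory.Transcendental.AxDerivationTools
import Literature.NumberTheory.Transcendental.AxDerivationExtension
import Literature.NumberTheory.Transcendental.DerivationExtension
import Literature.NumberTheory.Transcendental.LaurentEulerOperator
import Literature.NumberTheory.Transcendental.LiouvilleDescent
import HarnessLib

/-!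
# Rosenlicht 1976, Prop. 4 (⇒): proof by residues — discharge of `Rosenlicht1976_prop4`

Trunk T-TRANSCEND (`Literature/NumberTheory/Transcendental`). This file PROVES the named fact
`Literature.NumberTheory.Transcendental.Rosenlicht.Rosenlicht1976_prop4` (`RosenlichtDifferentials.lean`; M. Rosenlicht, *On
Liouville's theory of elementary functions*, Pacific J. Math. 65 (1976), Prop. 4), the one
transcendence input of the tree's proof of Ax's theorem (`AxSchanuelProofs.lean`:
`ax_schanuel_of_rosenlicht`) and hence of Kirby's weak Schanuel property
(`KirbyWeakSchanuelAx.lean`).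

**Statement.** `k ⊆ K` fields of characteristic zero, `c₁, …, cₙ ∈ k` linearly independent over
`ℚ`, `u₁, …, uₙ ∈ Kˣ`, `v ∈ K`: `Σ cᵢ duᵢ/uᵢ + dv = 0` in `Ω[K⁄k]` iff all `uᵢ` and `v` are
algebraic over `k`. (⇐) is `Rosenlicht1976_prop4_mpr`; here we prove (⇒).

**Proof** (Rosenlicht, loc. cit., proof of Prop. 4, in the language of derivations; the same
argument is Ax 1971, §2). The relation gives `Σ cᵢ δuᵢ/uᵢ + δv = 0` for every `k`-derivation
`δ` of `K` (`Derivation.liftKaehlerDifferential`). Suppose `b = u_{i₀}` is transcendental over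
`k`. Complete `b` to a transcendence basis, `k₁ = k(rest)`, so that `b` is transcendental over
`k₁` and `K` is algebraic over `L = k₁(b) ≅ k₁(X)` (`exists_derivation_of_transcendental`). Let
`θ = X·d/dX` on `L`, extended to the finite extension `K' = L(u, v)` (Mathlib's
`Differential` structure on finite extensions) and then to `K` (derivations extend along
characteristic-zero field extensions, `Derivation.exists_extension_of_charZero`). Since
`θb/b = 1`, the relation reads `-c_{i₀} = Σ_{i ≠ i₀} cᵢ θuᵢ/uᵢ + θv` in `K'`; Galois averaging
(`exists_nat_mul_eq_sum_logDeriv`, Rosenlicht's "take the trace") descends it to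
`-N c_{i₀} = Σ_{i ≠ i₀} cᵢ θUᵢ/Uᵢ + θV` with `Uᵢ, V ∈ L = k₁(X)`, `N ≥ 1`. Expanding in Laurent
series at `X = 0` (Rosenlicht: "write as partial fractions and compare"), the constant term of
`θU/U` is the integer `ord_X U` and that of `θV` is `0` (`LaurentEulerOperator.lean`), whence
`-N c_{i₀} = Σ_{i ≠ i₀} mᵢ cᵢ` with `mᵢ ∈ ℤ` — a non-trivial `ℚ`-linear relation among the `cᵢ`,
contradiction. So every `uᵢ` is algebraic, hence killed by every `δ`; then `δv = 0` for all `δ`,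
and `v` is algebraic (`exists_derivation_eq_one_of_transcendental`).

## Contents

* `Literature.NumberTheory.Transcendental.Rosenlicht.exists_eulerDerivation_ratFunc` — the `F`-derivation `X·d/dX` of `F(X)`.
* `Literature.NumberTheory.Transcendental.Rosenlicht.exists_int_rel_of_eq_sum_logDeriv` — constant terms: a log-derivative identity
  `a = Σ cᵢ θUᵢ/Uᵢ + θV` in `F(X)` with `a, cᵢ ∈ F` forces `a = Σ mᵢ cᵢ`, `mᵢ ∈ ℤ`.
* `Literature.NumberTheory.Transcendental.Rosenlicht.isAlgebraic_of_forall_derivation` — the `uᵢ` are algebraic (dual form).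
* `Literature.NumberTheory.Transcendental.Rosenlicht.Rosenlicht1976_prop4_mp`, `Literature.NumberTheory.Transcendental.Rosenlicht.Rosenlicht1976_prop4_holds`,
  `Literature.NumberTheory.Transcendental.Rosenlicht.Rosenlicht1976_prop4_iff` (the applicable form, `k K` in any universes).
* `Literature.NumberTheory.Transcendental.ax_schanuel_holds` — consequence: Ax's theorem (the named fact
  `ax_schanuel` of `AxSchanuel.lean`, Ax 1971 Thm. 3) holds, by `ax_schanuel_of_rosenlicht`
  (`AxSchanuelProofs.lean`).

## References

* M. Rosenlicht, *On Liouville's theory of elementary functions*, Pacific J. Math. 65 (1976),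
  485–492, Prop. 4 and its proof (pp. 486–487).
* J. Ax, *On Schanuel's conjectures*, Ann. of Math. 93 (1971), 252–268, §2.
-/

noncomputable section

open scoped Differential IntermediateField LaurentSeries
open Polynomial

namespace Literature.NumberTheory.Transcendental

namespace Rosenlicht

/-! ### The Euler derivation `X·d/dX` of `F(X)` -/

/-- The `F`-derivation `θ = X·d/dX` of the rational function field `F(X)` (`θ X = X`):
`d/dX` on `F[X]` extended to the fraction field, times `X`. [folklore] -/
theorem exists_eulerDerivation_ratFunc (F : Type*) [Field F] :
    ∃ θ : Derivation F (RatFunc F) (RatFunc F), θ RatFunc.X = RatFunc.X := by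
  obtain ⟨d, hd⟩ := exists_derivation_extend_of_isFractionRing (R := F) (A := F[X])
    (K := RatFunc F) ((Algebra.linearMap F[X] (RatFunc F)).compDer Polynomial.derivative')
  refine ⟨(RatFunc.X : RatFunc F) • d, ?_⟩
  rw [Derivation.smul_apply, smul_eq_mul]
  conv_lhs => rw [← RatFunc.algebraMap_X, hd]
  change RatFunc.X * algebraMap F[X] (RatFunc F) (derivative Polynomial.X) = RatFunc.X
  rw [Polynomial.derivative_X, map_one, mul_one]

/-! ### Constant terms of Laurent expansions: an integer relation -/

/-- **Comparing constant terms** (Rosenlicht 1976, proof of Prop. 4: "write `v` as a partial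
fraction … and compare"; Ax 1971, §2). If `a = Σ cᵢ · θUᵢ/Uᵢ + θV` in `F(X)` with `θ = X·d/dX`,
`a, cᵢ ∈ F`, `0 ≠ Uᵢ ∈ F(X)`, `V ∈ F(X)`, then `a = Σ mᵢ cᵢ` with `mᵢ = ord_X Uᵢ ∈ ℤ`: expand in
`F⸨X⸩`, where `θUᵢ/Uᵢ` has constant term `ord_X Uᵢ` and `θV` has constant term `0`.
[cite: Rosenlicht1976, Prop. 4 (proof)] -/
theorem exists_int_rel_of_eq_sum_logDeriv {F : Type*} [Field F]
    (θ : Derivation F (RatFunc F) (RatFunc F)) (hθ : θ RatFunc.X = RatFunc.X) {ι : Type*}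
    [Fintype ι] (a : F) (c : ι → F) (U : ι → RatFunc F) (hU : ∀ i, U i ≠ 0) (V : RatFunc F)
    (h : (RatFunc.C a : RatFunc F) = ∑ i, RatFunc.C (c i) * (θ (U i) / U i) + θ V) :
    ∃ m : ι → ℤ, a = ∑ i, (m i : F) * c i := by
  refine ⟨fun i => ((U i : RatFunc F) : F⸨X⸩).order, ?_⟩
  have h1 : ((RatFunc.C a : RatFunc F) : F⸨X⸩).coeff 0 =
      ((∑ i, RatFunc.C (c i) * (θ (U i) / U i) + θ V : RatFunc F) : F⸨X⸩).coeff 0 := by rw [h]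
  rw [LaurentEuler.coeff_zero_coe_C] at h1
  rw [h1, map_add, HahnSeries.coeff_add, LaurentEuler.coeff_zero_coe_derivation θ hθ, add_zero,
    map_sum, HahnSeries.coeff_sum]
  refine Finset.sum_congr rfl fun i _ => ?_
  rw [map_mul, LaurentEuler.coe_ratFunc_C, HahnSeries.C_mul_eq_smul, HahnSeries.coeff_smul,
    smul_eq_mul, LaurentEuler.coeff_zero_coe_derivation_div θ hθ (hU i), mul_comm]

/-! ### Elements moved by no derivation are algebraic -/

/-- If every `k`-derivation of `K` kills `v`, then `v` is algebraic over `k` (characteristic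
zero): a transcendental element is moved by `∂/∂v` (Rosenlicht 1976, Prop. 3; first sentence of
the proof of Prop. 4). [cite: Rosenlicht1976, Prop. 4 (proof)] -/
theorem isAlgebraic_of_forall_derivation_eq_zero {k K : Type*} [Field k] [CharZero k] [Field K]
    [Algebra k K] {v : K} (H : ∀ δ : Derivation k K K, δ v = 0) : IsAlgebraic k v := by
  by_contra hv
  obtain ⟨D, hD⟩ := exists_derivation_eq_one_of_transcendental (k := k) (K := K) hv
  exact one_ne_zero (hD ▸ H D)

/-! ### The main step: every `uᵢ` is algebraic -/

-- one self-contained argument through five fields `k ⊆ k₁ ⊆ L = k₁(b) ⊆ K' ⊆ K` and `k₁(X) ≅ L`;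
-- the coercion bookkeeping between them exceeds the default budget by a small factor
set_option maxHeartbeats 400000 in
/-- **Rosenlicht 1976, Prop. 4 (⇒), the `uᵢ`, dual form.** Let `k ⊆ K` be fields of
characteristic zero, `c₁, …, cₙ ∈ k` linearly independent over `ℚ`, `u₁, …, uₙ ∈ Kˣ`, `v ∈ K`,
and suppose `Σ cᵢ δuᵢ/uᵢ + δv = 0` for every `k`-derivation `δ` of `K`. Then every `uᵢ` is
algebraic over `k`. See the module docstring for the proof (transcendence basis through
`u_{i₀}`, `θ = X·d/dX` on `k₁(X)`, extension to `K`, Galois averaging down to `k₁(X)`,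
constant terms of Laurent expansions, `ℚ`-linear independence of the `cᵢ`).
[cite: Rosenlicht1976, Prop. 4] -/
theorem isAlgebraic_of_forall_derivation {k K : Type*} [Field k] [CharZero k] [Field K]
    [Algebra k K] {n : ℕ} (c : Fin n → k) (hc : LinearIndependent ℚ c) (u : Fin n → K)
    (hu : ∀ i, u i ≠ 0) (v : K)
    (H : ∀ δ : Derivation k K K, (∑ i, algebraMap k K (c i) * ((u i)⁻¹ * δ (u i))) + δ v = 0)
    (i₀ : Fin n) : IsAlgebraic k (u i₀) := by
  classical
  by_contra hb
  change Transcendental k (u i₀) at hb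
  haveI : CharZero K := charZero_of_injective_algebraMap (algebraMap k K).injective
  -- a transcendence basis through `b = u i₀`: `b` transcendental over `k₁`, `K` algebraic over `k₁(b)`
  obtain ⟨k₁, htr, halg, -⟩ := exists_derivation_of_transcendental hb
  set b : K := u i₀ with hb_def
  haveI : CharZero k₁ := charZero_of_injective_algebraMap (algebraMap k k₁).injective
  -- `L = k₁(b) ≅ k₁(X)`
  set L : IntermediateField k₁ K := k₁⟮b⟯ with hL_def
  haveI : CharZero L := charZero_of_injective_algebraMap (algebraMap k₁ L).injective
  haveI hLK : Algebra.IsAlgebraic L K := halg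
  set bL : L := IntermediateField.AdjoinSimple.gen k₁ b with hbL_def
  have hbL : (bL : K) = b := IntermediateField.AdjoinSimple.coe_gen k₁ b
  have hb0 : b ≠ 0 := hu i₀
  have hbL0 : bL ≠ 0 := fun h => hb0 (by rw [← hbL, h]; rfl)
  let e : RatFunc k₁ ≃ₐ[k₁] L := RatFunc.algEquivOfTranscendental b htr
  have heX : e RatFunc.X = bL := by
    apply Subtype.ext
    rw [hbL]
    exact RatFunc.algEquivOfTranscendental_X b htr
  -- the Euler derivation on `k₁(X)`, transported to `L`
  obtain ⟨θ₀, hθ₀X⟩ := exists_eulerDerivation_ratFunc k₁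
  obtain ⟨θL, hθL⟩ := exists_derivation_algEquiv_conj e θ₀
  have hθL' : ∀ y : L, e.symm (θL y) = θ₀ (e.symm y) := fun y => by
    conv_lhs => rw [← e.apply_symm_apply y, hθL]
    rw [e.symm_apply_apply]
  have hθLb : θL bL = bL := by rw [← heX, hθL, hθ₀X]
  -- `L` as a differential field
  letI dL : Differential L := ⟨θL.restrictScalars ℤ⟩
  have hderivL : ∀ y : L, y′ = θL y := fun _ => rfl
  -- `K' = L(u, v)`, a finite extension of `L`, with its differential structure
  set S : Set K := insert v (Set.range u) with hS_def
  set K' : IntermediateField L K := IntermediateField.adjoin L S with hK'_def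
  haveI : FiniteDimensional L K' := IntermediateField.finiteDimensional_adjoin fun x _ =>
    (Algebra.IsAlgebraic.isAlgebraic (R := L) x).isIntegral
  have huK' : ∀ i, u i ∈ K' := fun i =>
    IntermediateField.subset_adjoin L S (Set.mem_insert_of_mem _ ⟨i, rfl⟩)
  have hvK' : v ∈ K' := IntermediateField.subset_adjoin L S (Set.mem_insert v _)
  set u' : Fin n → K' := fun i => ⟨u i, huK' i⟩ with hu'_def
  set v' : K' := ⟨v, hvK'⟩ with hv'_def
  have hu'0 : ∀ i, u' i ≠ 0 := fun i h => hu i (congrArg Subtype.val h)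
  -- the derivation of `K'`, extended to `K`, is a `k`-derivation
  obtain ⟨θZ, hθZ⟩ := Derivation.exists_extension_of_charZero (R := ℤ) (F := K') (T := K) (M := K)
    ((Algebra.linearMap K' K).compDer Differential.deriv)
  have hθZ' : ∀ s : K', θZ (s : K) = ((s′ : K') : K) := fun s => hθZ s
  have hcoe : ∀ y : L, ((algebraMap L K' y : K') : K) = (y : K) := fun _ => rfl
  have hθZL : ∀ y : L, θZ (y : K) = ((θL y : L) : K) := fun y => by
    rw [← hcoe, hθZ', deriv_algebraMap, hderivL, hcoe]
  have hθZk : ∀ a : k, θZ (algebraMap k K a) = 0 := fun a => by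
    have h1 : algebraMap k K a = ((algebraMap k₁ L (algebraMap k k₁ a) : L) : K) := rfl
    rw [h1, hθZL, Derivation.map_algebraMap]
    rfl
  let θk : Derivation k K K :=
    { toFun := θZ
      map_add' := map_add θZ
      map_smul' := fun a x => derivation_map_smul_of_forall_algebraMap θZ hθZk a x
      map_one_eq_zero' := θZ.map_one_eq_zero
      leibniz' := fun x y => θZ.leibniz x y }
  have hθk : ∀ x, θk x = θZ x := fun _ => rfl
  -- the relation for `θ`, in `K`
  have hK : (∑ i, algebraMap k K (c i) * ((u i)⁻¹ * θZ (u i))) + θZ v = 0 := H θk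
  -- the coefficients in `k₁` and in `L`
  set c₁ : Fin n → k₁ := fun i => algebraMap k k₁ (c i) with hc₁_def
  set cL : Fin n → L := fun i => algebraMap k₁ L (c₁ i) with hcL_def
  have hcLK : ∀ i, ((cL i : L) : K) = algebraMap k K (c i) := fun _ => rfl
  -- the `i₀`-term is `c i₀`
  have hθZb : θZ b = b := by
    rw [← hbL, hθZL, hθLb]
  have hterm : algebraMap k K (c i₀) * ((u i₀)⁻¹ * θZ (u i₀)) = algebraMap k K (c i₀) := by
    rw [← hb_def, hθZb, inv_mul_cancel₀ hb0, mul_one]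
  -- the relation in `K'`, with the `i₀`-term moved to the left
  set a : L := -cL i₀ with ha_def
  have key : (algebraMap L K' a : K') =
      ∑ j : {j // j ≠ i₀}, algebraMap L K' (cL j) * Differential.logDeriv (u' j) + v'′ := by
    apply Subtype.val_injective
    have h2 : ∀ j, ((algebraMap L K' (cL j) * Differential.logDeriv (u' j) : K') : K) =
        algebraMap k K (c j) * ((u j)⁻¹ * θZ (u j)) := fun j => by
      rw [Differential.logDeriv, IntermediateField.coe_mul, IntermediateField.coe_div, hcoe, hcLK,
        ← hθZ', div_eq_inv_mul]
    simp only [IntermediateField.coe_add, IntermediateField.coe_sum, h2, ← hθZ']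
    rw [hcoe, ha_def]
    change (((-cL i₀ : L)) : K) = _
    rw [IntermediateField.coe_neg, hcLK]
    rw [Fintype.sum_eq_add_sum_subtype_ne _ i₀, hterm, add_assoc] at hK
    exact (neg_eq_of_add_eq_zero_right hK)
  -- Galois averaging: descend to `L`
  obtain ⟨N, hN, u₀, v₀, hu₀, hNa⟩ :=
    exists_nat_mul_eq_sum_logDeriv (F := L) (K := K') a (fun j : {j // j ≠ i₀} => cL j)
      (fun j => u' j) (fun j => hu'0 j) v' key
  -- transport to `k₁(X)` and compare constant terms
  set U : {j // j ≠ i₀} → RatFunc k₁ := fun j => e.symm (u₀ j) with hU_def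
  have hU0 : ∀ j, U j ≠ 0 := fun j => (map_ne_zero e.symm).mpr (hu₀ j)
  have hRat : (RatFunc.C ((N : k₁) * -c₁ i₀) : RatFunc k₁) =
      ∑ j : {j // j ≠ i₀}, RatFunc.C (c₁ j) * (θ₀ (U j) / U j) + θ₀ (e.symm v₀) := by
    have h3 := congrArg e.symm hNa
    rw [map_mul, map_natCast, ha_def, map_neg, AlgEquiv.commutes, RatFunc.algebraMap_eq_C,
      map_add, map_sum] at h3
    rw [map_mul, map_natCast, map_neg, h3, hderivL, hθL']
    congr 1
    refine Finset.sum_congr rfl fun j _ => ?_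
    rw [map_mul, AlgEquiv.commutes, RatFunc.algebraMap_eq_C, Differential.logDeriv, map_div₀,
      hderivL, hθL']
  obtain ⟨m, hm⟩ := exists_int_rel_of_eq_sum_logDeriv θ₀ hθ₀X _ _ U hU0 _ hRat
  -- back in `k`: a non-trivial `ℤ`-relation among the `cᵢ`
  have hrel : (N : k) * -c i₀ = ∑ j : {j // j ≠ i₀}, (m j : k) * c j := by
    apply (algebraMap k k₁).injective
    simpa only [map_mul, map_natCast, map_neg, map_sum, map_intCast] using hm
  let g : Fin n → ℚ := fun i => if h : i = i₀ then (N : ℚ) else (m ⟨i, h⟩ : ℚ)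
  have hg : ∑ i, g i • c i = 0 := by
    rw [Fintype.sum_eq_add_sum_subtype_ne _ i₀]
    have h5 : g i₀ = N := dif_pos rfl
    have h4 : ∀ j : {j // j ≠ i₀}, g j = (m j : ℚ) := fun j => dif_neg j.2
    simp only [h5, h4, Nat.cast_smul_eq_nsmul, nsmul_eq_mul, Int.cast_smul_eq_zsmul, zsmul_eq_mul]
    rw [← hrel]
    ring
  have := Fintype.linearIndependent_iff.mp hc g hg i₀
  simp only [g, dif_pos rfl, Nat.cast_eq_zero] at this
  exact hN this

/-! ### Rosenlicht's Prop. 4 -/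

/-- **Rosenlicht 1976, Prop. 4, direction (⇒).** With `k ⊆ K` of characteristic zero,
`cᵢ ∈ k` linearly independent over `ℚ`, `uᵢ ≠ 0`: if `Σ cᵢ duᵢ/uᵢ + dv = 0` in `Ω[K⁄k]` then
all `uᵢ` and `v` are algebraic over `k`. [cite: Rosenlicht1976, Prop. 4] -/
theorem Rosenlicht1976_prop4_mp {k K : Type*} [Field k] [CharZero k] [Field K] [Algebra k K]
    {n : ℕ} (c : Fin n → k) (hc : LinearIndependent ℚ c) (u : Fin n → K) (hu : ∀ i, u i ≠ 0)
    (v : K)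
    (H : (∑ i, algebraMap k K (c i) • (u i)⁻¹ • KaehlerDifferential.D k K (u i)) +
      KaehlerDifferential.D k K v = 0) :
    (∀ i, IsAlgebraic k (u i)) ∧ IsAlgebraic k v := by
  -- dual form: the relation holds for every `k`-derivation `δ : K → K`
  have H' : ∀ δ : Derivation k K K,
      (∑ i, algebraMap k K (c i) * ((u i)⁻¹ * δ (u i))) + δ v = 0 := by
    intro δ
    have h := congrArg δ.liftKaehlerDifferential H
    rw [map_add, map_sum, map_zero, Derivation.liftKaehlerDifferential_comp_D] at h
    simpa only [map_smul, Derivation.liftKaehlerDifferential_comp_D, smul_eq_mul] using h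
  have hu' : ∀ i, IsAlgebraic k (u i) := isAlgebraic_of_forall_derivation c hc u hu v H'
  refine ⟨hu', isAlgebraic_of_forall_derivation_eq_zero fun δ => ?_⟩
  have h := H' δ
  have h0 : ∀ i, δ (u i) = 0 := fun i => derivation_eq_zero_of_isAlgebraic δ (hu' i)
  simpa only [h0, mul_zero, Finset.sum_const_zero, zero_add] using h

/-- **Rosenlicht 1976, Prop. 4** — the named fact `Rosenlicht1976_prop4` of
`RosenlichtDifferentials.lean` holds. [cite: Rosenlicht1976, Prop. 4] -/
theorem Rosenlicht1976_prop4_holds : Rosenlicht1976_prop4 := by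
  intro k K _ _ _ _ n c u v hc hu
  exact ⟨fun H => Rosenlicht1976_prop4_mp c hc u hu v H,
    fun h => Rosenlicht1976_prop4_mpr c u v h.1 h.2⟩

/-- **Rosenlicht 1976, Prop. 4**, directly applicable universe-polymorphic form: for fields
`k ⊆ K` of characteristic zero (in any universes; the named fact `Rosenlicht1976_prop4`
quantifies over `k K : Type`), `cᵢ ∈ k` linearly independent over `ℚ` and `uᵢ ≠ 0`,
`Σ cᵢ duᵢ/uᵢ + dv = 0` in `Ω[K⁄k]` iff all `uᵢ` and `v` are algebraic over `k`
(`Rosenlicht1976_prop4_mp` and `Rosenlicht1976_prop4_mpr`). [cite: Rosenlicht1976, Prop. 4] -/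
theorem Rosenlicht1976_prop4_iff {k K : Type*} [Field k] [CharZero k] [Field K] [Algebra k K]
    {n : ℕ} (c : Fin n → k) (hc : LinearIndependent ℚ c) (u : Fin n → K) (hu : ∀ i, u i ≠ 0)
    (v : K) :
    (∑ i, algebraMap k K (c i) • (u i)⁻¹ • KaehlerDifferential.D k K (u i)) +
        KaehlerDifferential.D k K v = 0 ↔
      (∀ i, IsAlgebraic k (u i)) ∧ IsAlgebraic k v :=
  ⟨fun H => Rosenlicht1976_prop4_mp c hc u hu v H, fun h => Rosenlicht1976_prop4_mpr c u v h.1 h.2⟩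

end Rosenlicht

end Literature.NumberTheory.Transcendental

/-! ### Consequence: Ax's theorem holds -/

namespace Literature.NumberTheory.Transcendental

/-- **Ax's theorem HOLDS** (Ax 1971, Thm. 3, for finite families of derivations, with the rank
term: the named fact `ax_schanuel` of `AxSchanuel.lean`): `AxSchanuelProofs.lean` reduces it to
Rosenlicht's Prop. 4 (`ax_schanuel_of_rosenlicht`), which is `Rosenlicht.Rosenlicht1976_prop4_holds`
above. [cite: Ax1971, Thm. 3] -/
theorem ax_schanuel_holds : ax_schanuel :=
  ax_schanuel_of_rosenlicht Rosenlicht.Rosenlicht1976_prop4_holds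

end Literature.NumberTheory.Transcendental
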